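import Summits.ABC.ABC.Theses.CubicResolventAllowance
import Literature.NumberTheory.CubicFields.MaximalCubicRings
import Literature.NumberTheory.Sieve.PowerfulPartDecomposition
import Literature.NumberTheory.DiophantineApproximation.SPartPolynomialValues
import Literature.NumberTheory.DiophantineGeometry.AbcWave0
import Mathlib.NumberTheory.Padics.Complex
import HarnessLib

/-!
# Stub-ideation k=2 (RESHAPE), GEN 5 — `stub_realCubic` of crux `IndexSzpiro` (stmt-ABC-22740)

Companion of `STUB-IDEAS-stub_realCubic-2.md` (gen 5).  Gens 2–4 (this directory:
`StubIdeas2Sketch.lean` dictionary `E ↦ (F,(u,v))`, CORE A `IndexFormSzpiroReal`, `assemblyT`;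
`StubIdeas2RealG4Sketch.lean` kernel normal forms `MUR ⇒ Kernel ⇒ SUR ⇒ UR₁`) are mirrored in §0.
Gen 5 uses what the TREE now has and gen 4 did not know: Roth's theorem (`roth_holds`) and the
`p`-adic Roth theorem over `ℚ` with archimedean target `0` (`Ridout.finite_of_abs_le_one`,
`Ridout.false_of_class_abs`, `Ridout.indexTheorem` — the last one ALREADY for arbitrary algebraic
targets at every place), plus the abc-side precedent `ridoutCoreBound_holds` / `UniformSadicTowerFour`
(route IneffectiveSubspace: rational targets `0,1,∞` = the `r ≥ 1` Frey class).

* §R  FLOOR (provable now).  `RothRidoutQ` (B–G Thm 6.2.3 for `K = ℚ` IN FULL: irrational real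
  target; one merge of `RothAssembly` with `RidoutRationalsClass`) ⇒ `SPartBound F` (Bugeaud–Evertse–
  Győry 2018 Prop. 3.1 for the cubic form: `[F(u,v)]_S · X^{1−ε} ≤ C(F,S,ε)|F(u,v)|`) ⇒
  `CoreAFixedSupport F S` (CORE A for one field, powerful part of the index confined to `S`) ⇒
  `SzpiroOnClassWithSupport` (Szpiro `6+ε`, constant `C(K,S,ε)`, on the `r = 0` class of `K` with all
  multiplicative fibres `I_n, n ≥ 4` at primes of `S`).  The `r = 0` INPUT is Roth proper: targets are the
  conjugates of the 2-division root, irrational because `ψ₂` is irreducible.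
* §L  LADDER = S-adic interpolation Roth → Ridout → MUR.  `Cell F K` (uniform over `|S| ≤ K` with the
  LINEAR loss `(∏_{p∈S} p)^{1+ε}` that IneffectiveSubspace found forced) and `DeepTail F`;
  `Cell F 0 ⟸ roth`; `(∀ K, Cell F K) ∧ DeepTail F ⇒ Kernel` (take `S` = powerful support); `MUR ⟺ Cell_∞`.
* §Q  COUNT.  `CountLargeOnePrime` — B–G 6.5.7 (6.23): per `(F, p, ρ)` at most `N₀(δ)` LARGE
  solutions, `N₀` independent of `p`; so `Cell F 1` is a HEIGHT statement about `≤ N₀(δ)` sporadic points.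
* §C  PRIME-POWER RUNG (the `m' = 1` slice of `Cell F 1`, `r = 0`-specific): `PrimePowerIndexBound F`
  (`F(u,v) = ±p^k ⇒ k ≤ 3` for `p ≥ p₀(K)`) ⟸ `BDFinite F` (Bennett–Dahmen 2013 Thm 1.1 + Darmon–Granville,
  hypothesis `OmitsSUnits F`), PROVED here; sharp at `k = 3` (k3's cube families); curve reading
  `SzpiroOnePrimeSlice` (exponent exactly 6).
* §I  `r = 0` as a resource, cheapest instance: inert primes never divide the index (S).

`sorry` marks PROPOSED helper lemmas (sizes in docstrings); §C4 and §L0 are proved.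
-/

noncomputable section

open scoped Classical
open Polynomial NumberField WeierstrassCurve Finset
open Literature.NumberTheory.CubicFields Literature.NumberTheory.CubicFields.BinaryCubic
open Literature.NumberTheory.DiophantineApproximation

namespace Summit.ABC.ABC.Cruxes.IndexSzpiro.StubIdeas2RealG5

/-! ## §0 The stub (verbatim) and the gen-2/gen-4 objects (mirrored; those files are not farm modules) -/

/-- The stub, verbatim (registered skeleton, `stub_realCubic`). -/
def StubRealCubic : Prop :=
  ∀ ε : ℝ, 0 < ε → ∃ C : ℝ, ∀ (W : WeierstrassCurve ℚ) [W.IsElliptic] (K : Type) [Field K] [NumberField K],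
    Irreducible W.twoTorsionPolynomial.toPoly → Module.finrank ℚ K = 3 →
    (∃ θ : K, aeval θ W.twoTorsionPolynomial.toPoly = 0) → 0 < NumberField.discr K →
    (W.minimalDiscriminantNorm ℤ : ℝ) ≤ C * |(NumberField.discr K : ℝ)| * (W.conductorNorm ℤ : ℝ) ^ (6 + ε)

/-- Radical of a natural number. -/
def rad (n : ℕ) : ℕ := n.primeFactors.prod id

/-- `|F(P)|` = the index `[𝓞_K : ℤ[θ_P]]` for the index form `F` of `K` and `P` primitive (gen 2). -/
def absVal (F : BinaryCubic ℤ) (P : ℤ × ℤ) : ℕ := (F.eval P.1 P.2).natAbs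

/-- Sup norm `X = |P|` of a lattice point. -/
def supNorm (P : ℤ × ℤ) : ℤ := max |P.1| |P.2|

/-- Naive height of the form. -/
def formHeight (F : BinaryCubic ℤ) : ℤ := |F.a| + |F.b| + |F.c| + |F.d|

/-- Hessian covariant value `H_F(u,v)` (gen 2 `hessEval`, verbatim). -/
def hessEval (F : BinaryCubic ℤ) (u v : ℤ) : ℤ :=
  (F.b ^ 2 - 3 * F.a * F.c) * u ^ 2 + (F.b * F.c - 9 * F.a * F.d) * u * v + (F.c ^ 2 - 3 * F.b * F.d) * v ^ 2

/-- The `5`-rough conductor proxy (gen 2, verbatim): `∏_{p ≥ 5, p ∣ disc F·F(u,v)} p^(1 + [p ∣ H_F(u,v)])`. -/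
def conductorProxy (F : BinaryCubic ℤ) (u v : ℤ) : ℕ :=
  ∏ p ∈ ((F.disc * F.eval u v).natAbs.primeFactors.filter (fun p => 5 ≤ p)),
    p ^ (if (p : ℤ) ∣ hessEval F u v then 2 else 1)

/-- CORE A (gen 2, verbatim): index-form Szpiro for totally real cubic fields. `assemblyT : CORE A → stub`. -/
def IndexFormSzpiroReal : Prop :=
  ∀ ε : ℝ, 0 < ε → ∃ C : ℝ, ∀ F : BinaryCubic ℤ, F.IsIrreducible → RingOfForm.IsMaximal F → 0 < F.disc →
    ∀ u v : ℤ, IsCoprime u v →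
      |((F.eval u v : ℤ) : ℝ)| ≤ C * (conductorProxy F u v : ℝ) ^ (3 + ε)

variable (F : BinaryCubic ℤ)

/-- The fixed-form KERNEL (gen 4, verbatim): `|F(P)| ≤ C·rad(F(P))^{3+ε}` on primitive points. -/
def Kernel (C ε : ℝ) : Prop :=
  ∀ P : ℤ × ℤ, IsCoprime P.1 P.2 → (absVal F P : ℝ) ≤ C * (rad (absVal F P) : ℝ) ^ (3 + ε)

/-! ## §R  FLOOR — joint Roth–Ridout over `ℚ` (B–G 6.2.3, `K = ℚ`) and what it gives on the class -/

/-- R0 (L, LITERATURE; provable in-tree by merging `Roth.indexGe_nearbyRationals`/`RothAssembly` (archimedean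
Taylor estimate at an ALGEBRAIC target) into `Ridout.false_of_class_abs` (target `0`), the several-targets
`Ridout.indexTheorem` being target-general already).  **Bombieri–Gubler Thm. 6.2.3 for `K = ℚ`** (Ridout 1958
as printed): for primes `S`, `p`-adic algebraic-integer targets `θ_p`, a real irrational algebraic integer
`α` and `κ > 2`, only finitely many rationals `ρ` have
`min(1,|ρ − α|) · ∏_{p∈S} min(1, ‖ρ − θ_p‖_p) ≤ H(ρ)^{−κ}`.  [cite: BombieriGubler2006 Thm 6.2.3, PDF p.151;
Ridout1958] -/
def RothRidoutQ : Prop :=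
  ∀ (S : Finset Nat.Primes) (Q : Nat.Primes → ℤ[X]), (∀ p ∈ S, (Q p).Monic) → (∀ p ∈ S, 1 ≤ (Q p).natDegree) →
    ∀ (θ : ∀ p : Nat.Primes, @PadicAlgCl (p : ℕ) ⟨p.2⟩), (∀ p ∈ S, Polynomial.aeval (θ p) (Q p) = 0) →
    ∀ (Q₀ : ℤ[X]) (α : ℝ), Q₀.Monic → Polynomial.aeval α Q₀ = 0 → Irrational α →
    ∀ κ : ℝ, 2 < κ →
      {ρ : ℚ | min (1 : ℝ) |(ρ : ℝ) - α| *
          (∏ p ∈ S, min (1 : ℝ) ‖(ρ : @PadicAlgCl (p : ℕ) ⟨p.2⟩) - θ p‖) ≤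
        (max (|ρ.num| : ℝ) (ρ.den : ℝ)) ^ (-κ)}.Finite

/-- R1. **BEG 2018 Prop. 3.1 for the cubic form `F`** (per finite set of primes `S`, ineffective):
`[F(u,v)]_S · X^{1−ε} ≤ C(F,S,ε) · |F(u,v)|` on coprime `(u,v)`, `X = max(|u|,|v|)`; i.e. the `S`-free part of
the index is `≫ X^{1−ε}`.  [cite: BugeaudEvertseGyory2018 Prop 3.1 (n = 3), arXiv:1708.08290 §3] -/
def SPartBound : Prop :=
  ∀ (S : Finset ℕ), (∀ p ∈ S, p.Prime) → ∀ ε : ℝ, 0 < ε → ∃ C : ℝ, 0 < C ∧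
    ∀ u v : ℤ, IsCoprime u v → F.eval u v ≠ 0 →
      (sPart S (F.eval u v) : ℝ) * (supNorm (u, v) : ℝ) ^ (1 - ε) ≤ C * |((F.eval u v : ℤ) : ℝ)|

/-- R2 (M). `RothRidoutQ ⇒ SPartBound F` for irreducible `F` with `disc F ≠ 0` — BEG §3 at coprime pairs:
closest-root lemma at each `p ∈ S` and at `∞` (three real or one real root; `F(1,0) = a ≠ 0`), product formula
`∏_{p∈S}|F(u,v)|_p = 1/[F(u,v)]_S`, `3^{|S|+1}` choices of nearest roots, Roth–Ridout with `κ = 2 + ε`,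
finitely many exceptions absorbed into `C`.  [cite: BugeaudEvertseGyory2018 §3] -/
theorem sPartBound_of_rothRidout (h : RothRidoutQ) (hirr : F.IsIrreducible) (hd : F.disc ≠ 0) :
    SPartBound F := by
  sorry

/-- R3. CORE A for ONE form with the powerful part of the index CONFINED to `S`:
`∀ ε ∃ C(F,S,ε)`, for coprime `(u,v)` such that every `p ≥ 5` with `p² ∣ F(u,v)` lies in `S`,
`|F(u,v)| ≤ C · conductorProxy^{3+ε}`. -/
def CoreAFixedSupport (S : Finset ℕ) : Prop :=
  ∀ ε : ℝ, 0 < ε → ∃ C : ℝ, ∀ u v : ℤ, IsCoprime u v →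
    (∀ p : ℕ, p.Prime → 5 ≤ p → ((p : ℤ) ^ 2 ∣ F.eval u v) → p ∈ S) →
      |((F.eval u v : ℤ) : ℝ)| ≤ C * (conductorProxy F u v : ℝ) ^ (3 + ε)

/-- R3 (S/M). `SPartBound F ⇒ CoreAFixedSupport F S`: apply R1 with `S' = S ∪ {2,3}` and `ε ↦ ε/(3+ε)`; write
`|F| = [F]_{S'}·m'`; `m'` is squarefree and `5`-rough, each of its primes divides `F(u,v)` hence the proxy, so
`m' ≤ conductorProxy`; R1 gives `X^{1−ε} ≤ C m'`; finally `|F(u,v)| ≤ formHeight F · X³`. -/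
theorem coreAFixedSupport_of_sPartBound (h : SPartBound F) (hirr : F.IsIrreducible) (hd : 0 < F.disc)
    (S : Finset ℕ) (hS : ∀ p ∈ S, p.Prime) : CoreAFixedSupport F S := by
  sorry

/-- R4. THE CURVE-LANGUAGE RUNG.  Szpiro `6+ε` with constant `C(K,S,ε)` on the `r = 0` class of a totally real
cubic field `K`, restricted to curves whose multiplicative fibres of type `I_n, n ≥ 4` at primes `p ≥ 5, p ∤ d_K`
all lie in `S` (by T4/T5 of gen 2: `p ∤ g·d_K, p ∣ F(u,v)` ⇒ multiplicative with `n_p = 2·v_p(F(u,v))`). -/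
def SzpiroOnClassWithSupport (S : Finset ℕ) : Prop :=
  ∀ (K : Type) [Field K] [NumberField K], Module.finrank ℚ K = 3 → 0 < NumberField.discr K →
    ∀ ε : ℝ, 0 < ε → ∃ C : ℝ, ∀ (W : WeierstrassCurve ℚ) [W.IsElliptic],
      Irreducible W.twoTorsionPolynomial.toPoly → (∃ θ : K, aeval θ W.twoTorsionPolynomial.toPoly = 0) →
      (∀ p : ℕ, p.Prime → 5 ≤ p → ¬ ((p : ℤ) ∣ NumberField.discr K) →
          p ∣ W.conductorNorm ℤ → ¬ (p ^ 2 ∣ W.conductorNorm ℤ) → p ^ 4 ∣ W.minimalDiscriminantNorm ℤ → p ∈ S) →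
      (W.minimalDiscriminantNorm ℤ : ℝ) ≤ C * |(NumberField.discr K : ℝ)| * (W.conductorNorm ℤ : ℝ) ^ (6 + ε)

/-- R4 (M/L, the gen-2 dictionary T1–T6 / `assemblyT` run for one field: `W ≅ E_{F,gu,gv}`, `g` squarefree,
`Δ_min ∣ 2⁴3¹²g⁶·d_K·F(u,v)²`, `N ≥ conductorProxy·(g-part)²`; the support hypothesis on `W` is exactly the
support hypothesis of R3 on `(u,v)` off the primes of `6·g·d_K`, which go into `S` for free). -/
theorem szpiroOnClassWithSupport_of_coreA
    (h : ∀ F : BinaryCubic ℤ, F.IsIrreducible → RingOfForm.IsMaximal F → 0 < F.disc →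
      ∀ S : Finset ℕ, (∀ p ∈ S, p.Prime) → CoreAFixedSupport F S)
    (S : Finset ℕ) (hS : ∀ p ∈ S, p.Prime) : SzpiroOnClassWithSupport S := by
  sorry

/-! ## §L  LADDER — S-adic interpolation between Roth (`|S| = 0`, tree), Ridout (fixed `S`, §R) and MUR -/

/-- `Cell F K`: the Roth–Ridout inequality UNIFORMLY over all sets of at most `K` primes, with the LINEAR
`S`-loss `(∏_{p∈S} p)^{1+ε}` (the normalisation IneffectiveSubspace/`UniformSadicTowerFour` found forced on the
abc side; `(∏ p)^{ε}` is heuristically false here too: expected exceptions `≍ Σ_p p^{−A}`). OPEN for `K ≥ 1`. -/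
def Cell (K : ℕ) : Prop :=
  ∀ ε : ℝ, 0 < ε → ∃ C : ℝ, 0 < C ∧ ∀ (S : Finset ℕ), (∀ p ∈ S, p.Prime) → S.card ≤ K →
    ∀ u v : ℤ, IsCoprime u v → F.eval u v ≠ 0 →
      (sPart S (F.eval u v) : ℝ) * (supNorm (u, v) : ℝ) ^ (1 - ε) ≤
        C * (∏ p ∈ S, (p : ℝ)) ^ (1 + ε) * |((F.eval u v : ℤ) : ℝ)|

/-- Number of primes at which the index is powerful (`p² ∣ F(P)`): the depth count `ω_□`. -/
def omegaSq (P : ℤ × ℤ) : ℕ := ((absVal F P).primeFactors.filter (fun p => p ^ 2 ∣ absVal F P)).card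

/-- `DeepTail F`: the kernel on an `ε`-DEPENDENT deep tail `ω_□(F(P)) ≥ K(ε)` (the analogue of `DeepRegimeABC`;
implied by CORE A; refutable by one family with `ω_□ → ∞` and kernel ratio `> 3+δ`). OPEN. -/
def DeepTail : Prop :=
  ∀ ε : ℝ, 0 < ε → ∃ K : ℕ, ∃ C : ℝ, ∀ P : ℤ × ℤ, IsCoprime P.1 P.2 → K ≤ omegaSq F P →
    (absVal F P : ℝ) ≤ C * (rad (absVal F P) : ℝ) ^ (3 + ε)

/-- L0 (proved): the bottom rung is vacuous bookkeeping — with no primes the `S`-part is `1`. -/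
theorem sPart_empty_cast (m : ℤ) : (sPart ∅ m : ℝ) = 1 := by
  simp [sPart_empty]

/-- L1 (M). `Cell F 0 ⟸ Roth` (tree `roth_holds`): `|F(u,v)| ≥ c(F,ε) X^{1−ε}` for an irreducible cubic form —
closest real root + `roth` for each root of `F(x,1)` (irrational since `F` is irreducible), and `|v|` vs `|u|`
bookkeeping when `|u| > c|v|`. -/
theorem cell_zero_of_roth (hR : Literature.NumberTheory.DiophantineGeometry.roth) (hirr : F.IsIrreducible)
    (hd : F.disc ≠ 0) : Cell F 0 := by
  sorry

/-- L2 (S). For FIXED `S` the cell inequality is R1 with the constant allowed to depend on `S`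
(so every `Cell F K` is "R1 with `C(F,S,ε) ≤ C(F,K,ε)·(∏_{p∈S}p)^{1+ε}`": a pure UNIFORMITY statement). -/
theorem sPartBound_of_cells (h : ∀ K, Cell F K) : SPartBound F := by
  sorry

/-- L3 (S/M). `(∀ K, Cell F K) ∧ DeepTail F ⇒ ∀ ε ∃ C, Kernel F C ε`: on `ω_□(F(P)) ≥ K(ε)` use the tail; below
it apply `Cell F K(ε)` with `S :=` the powerful support of `F(P)`: `[F]_S = ` powerful part, the cofactor `m'` is
squarefree so `(∏_{p∈S}p)·m' ≤ rad F(P)` and `X^{1−ε} ≤ C·rad(F(P))^{1+ε}`, whence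
`|F(P)| ≤ formHeight·X³ ≤ C'·rad^{3(1+ε)/(1−ε)}`; take the max of the two constants. -/
theorem kernel_of_cells_deepTail (hc : ∀ K, Cell F K) (ht : DeepTail F) (hirr : F.IsIrreducible) :
    ∀ ε : ℝ, 0 < ε → ∃ C : ℝ, Kernel F C ε := by
  sorry

/-- L4 (S). The TOP of the ladder is MUR (gen 4): with `S ⊇` the support of `F(P)`, the cell inequality reads
`X^{1−ε} ≤ C·rad(F(P))^{1+ε}`; conversely MUR gives every cell with loss exponent exactly `1`
(`rad F(P) ≤ (∏_{p∈S}p)·m'`).  Stated as the implication used downstream. -/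
theorem cells_of_mur (h : ∀ ε' : ℝ, 0 < ε' → ∃ C : ℝ, 0 < C ∧ ∀ P : ℤ × ℤ, IsCoprime P.1 P.2 → F.eval P.1 P.2 ≠ 0 →
      (supNorm P : ℝ) ^ (1 - ε') ≤ C * (rad (absVal F P) : ℝ)) : ∀ K, Cell F K := by
  sorry

/-! ## §Q  COUNT — quantitative Roth: the number of LARGE exceptions is uniform in `p` (B–G 6.5.7) -/

/-- Q1 (LITERATURE, named-fact shape). **B–G 6.5.7, (6.23) with `|S| = 1`, `r = [ℚ(θ):ℚ] = 3`**: for `δ > 0` there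
is `N₀(δ)` such that for every irreducible cubic form `F` there is a threshold `X₀(F,δ)` (the "large solutions",
`h(β) > L`, `L` depending on the height of `θ` only — the same for every conjugate `θ_p`) such that for EVERY
prime `p` and every `ℤ_p`-root `ρ` of `F(x,1)`, at most `N₀` coprime `P = (u,v)` with `|P| ≥ X₀` satisfy
`‖u − ρ v‖_p ≤ |P|^{−(2+δ)}`.  The count does not depend on `p`; the HEIGHTS of these `≤ N₀` sporadic points are
what `Cell F 1` is about.  [cite: BombieriGubler2006 6.5.6–6.5.7 (6.23), PDF pp.168–169; DavenportRoth1955 for |S|=1] -/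
def CountLargeOnePrime : Prop :=
  ∀ δ : ℝ, 0 < δ → ∃ N₀ : ℕ, ∀ F : BinaryCubic ℤ, F.IsIrreducible → ∃ X₀ : ℝ,
    ∀ (p : ℕ) [Fact p.Prime] (ρ : ℤ_[p]), Polynomial.aeval ρ F.toCubic.toPoly = 0 →
      {P : ℤ × ℤ | IsCoprime P.1 P.2 ∧ X₀ ≤ (supNorm P : ℝ) ∧
          ‖((P.1 : ℤ) : ℤ_[p]) - ρ * ((P.2 : ℤ) : ℤ_[p])‖ ≤ (supNorm P : ℝ) ^ (-(2 + δ))}.ncard ≤ N₀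

/-! ## §C  PRIME-POWER RUNG — the `m' = 1` slice of `Cell F 1`; modular method + Darmon–Granville ALIVE here -/

/-- C0. `F` never represents an `S_F`-unit, `S_F = {p ∣ 2·disc F}` (Bennett–Dahmen's hypothesis; fails for index
forms of MONOGENIC fields since `F(P₀) = ±1`; B–D §12: heuristically density one among cubic forms). -/
def OmitsSUnits : Prop :=
  ∀ u v : ℤ, IsCoprime u v → ∃ p : ℕ, p.Prime ∧ ¬ (p ∣ 2 * F.disc.natAbs) ∧ p ∣ (F.eval u v).natAbs

/-- C1. The Bennett–Dahmen finiteness conclusion: finitely many `(u, v, w, l)` with `(u,v)` coprime, `l ≥ 4`,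
`|w| ≥ 2`, `|F(u,v)| = |w|^l`. -/
def BDFinite : Prop :=
  {x : ℤ × ℤ × ℤ × ℕ | IsCoprime x.1 x.2.1 ∧ 4 ≤ x.2.2.2 ∧ 2 ≤ x.2.2.1.natAbs ∧
      (F.eval x.1 x.2.1).natAbs = x.2.2.1.natAbs ^ x.2.2.2}.Finite

/-- C2 (LITERATURE, named-fact shape). **Bennett–Dahmen 2013, Thm. 1.1** (with its "consequently" clause, which
uses Darmon–Granville 1995 for the small exponents): an irreducible binary cubic form that never represents an
`S_F`-unit has `BDFinite`.  Proof there: Frey–Hellegouarch curves `E_{x,y}: Y² = X³ + 3H X + G` with CONSTANT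
2-torsion (= our class: `ℚ(E[2]) ⊃ K` fixed), level lowering to level `| 2^a·3^b·rad(disc F)^2`, `l > l₀(F)` effective.
[cite: BennettDahmen2013 Thm 1.1, Ann. of Math. 177 (2013) 171–239, pp.173–174; DarmonGranville1995 Thm 1] -/
def BennettDahmen2013 : Prop :=
  ∀ F : BinaryCubic ℤ, F.IsIrreducible → OmitsSUnits F → BDFinite F

/-- C3. THE RUNG `P1`: prime-power indices have exponent `≤ 3` beyond `p₀(K)`
(`[𝓞_K : ℤ[α]] = p^k ⇒ k ≤ 3`); in curve terms Szpiro with exponent EXACTLY `6` on the one-multiplicative-prime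
slice of the class (C5).  Sharp: `k = 3` occurs in families (k3 gen 4, `ℚ(ζ₇)⁺`). OPEN for monogenic `K`. -/
def PrimePowerIndexBound : Prop :=
  ∃ p₀ : ℕ, ∀ p : ℕ, p.Prime → p₀ ≤ p → ∀ u v : ℤ, IsCoprime u v → ∀ k : ℕ,
    (F.eval u v).natAbs = p ^ k → k ≤ 3

/-- C4 (S, PROVED). `BDFinite F ⇒ PrimePowerIndexBound F`: a prime-power value `p^k`, `k ≥ 4`, is the point
`(u, v, p, k)` of the finite set; take `p₀` beyond all of them. -/
theorem primePowerIndexBound_of_bdFinite (h : BDFinite F) : PrimePowerIndexBound F := by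
  classical
  obtain ⟨T, hT⟩ := h.exists_finset_coe
  refine ⟨T.sup (fun x => x.2.2.1.natAbs) + 1, ?_⟩
  intro p hp hp₀ u v huv k hk
  rcases Nat.lt_or_ge k 4 with hk4 | hk4
  · omega
  · exfalso
    have hmem : (u, v, (p : ℤ), k) ∈ {x : ℤ × ℤ × ℤ × ℕ | IsCoprime x.1 x.2.1 ∧ 4 ≤ x.2.2.2 ∧
        2 ≤ x.2.2.1.natAbs ∧ (F.eval x.1 x.2.1).natAbs = x.2.2.1.natAbs ^ x.2.2.2} :=
      ⟨huv, hk4, by simpa using hp.two_le, by simpa using hk⟩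
    rw [← hT] at hmem
    have hle : p ≤ T.sup (fun x => x.2.2.1.natAbs) := by
      simpa using Finset.le_sup (f := fun x : ℤ × ℤ × ℤ × ℕ => x.2.2.1.natAbs) (Finset.mem_coe.mp hmem)
    omega

/-- C5. Curve reading of C3 (statement; M via the gen-2 dictionary): on the `r = 0` class of `K` (index form
omitting `S_K`-units), a curve all of whose bad primes `q ∤ 6·d_K` coincide with ONE multiplicative prime
`p ≥ p₀(K)` has `v_p(Δ_min) ≤ 6`, hence `Δ_min ≤ C(K)·N⁶` on that slice (the twist `g` divides `6 d_K` there). -/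
def SzpiroOnePrimeSlice : Prop :=
  ∀ (K : Type) [Field K] [NumberField K], Module.finrank ℚ K = 3 → 0 < NumberField.discr K →
    (∀ F : BinaryCubic ℤ, F.IsIrreducible → RingOfForm.IsMaximal F → F.disc = NumberField.discr K → OmitsSUnits F) →
    ∃ p₀ : ℕ, ∃ C : ℝ, ∀ (W : WeierstrassCurve ℚ) [W.IsElliptic],
      Irreducible W.twoTorsionPolynomial.toPoly → (∃ θ : K, aeval θ W.twoTorsionPolynomial.toPoly = 0) →
      ∀ p : ℕ, p.Prime → p₀ ≤ p →
        (∀ q : ℕ, q.Prime → q ∣ W.conductorNorm ℤ → (q : ℤ) ∣ 6 * NumberField.discr K ∨ (q = p ∧ ¬ q ^ 2 ∣ W.conductorNorm ℤ)) →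
        (W.minimalDiscriminantNorm ℤ : ℝ) ≤ C * (W.conductorNorm ℤ : ℝ) ^ (6 : ℝ)

/-- C5 (M). `BennettDahmen2013 ⇒ SzpiroOnePrimeSlice` through the dictionary (`Δ_min = 2^a3^b g⁶ d_K F(u,v)²`,
`F(u,v) = ±p^k·(6 d_K-part)`, C3 ⇒ `k ≤ 3`; the `6·d_K`-supported parts are bounded per `K` by Thue–Mahler =
R1 with `S = {p ∣ 6 d_K}`, or absorbed into `C(K)`). -/
theorem szpiroOnePrimeSlice_of_bd (h : BennettDahmen2013) (hR : RothRidoutQ) : SzpiroOnePrimeSlice := by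
  sorry

/-! ## §I  `r = 0` as a resource, cheapest instance: inert primes never divide the index -/

/-- I1 (S). If `F` has no root in `P¹(𝔽_p)` (`p ∤ a = F(1,0)` and `F(t,1) ≢ 0 (mod p)` for all `t`), then
`p ∤ F(u,v)` for all coprime `(u,v)`.  For the index form of `𝓞_K` and `p ∤ 6·d_K` this is: `p` INERT in `K` ⇒ no
tower at `p` at all; towers live on the `≤ 3` root classes (split/partially split primes), never on inert ones —
the non-archimedean face of "irreducible `ψ₂`" that the Frey class (`r ≥ 1`, roots `0, 1, ∞` mod every `p`) lacks. -/
theorem not_dvd_eval_of_no_root {p : ℕ} (hp : p.Prime) (ha : ¬ ((p : ℤ) ∣ F.a))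
    (hno : ∀ t : ZMod p, (F.map (Int.castRingHom (ZMod p))).eval t 1 ≠ 0) :
    ∀ u v : ℤ, IsCoprime u v → ¬ ((p : ℤ) ∣ F.eval u v) := by
  sorry

/-! ## Assembly of the gen-5 items toward the stub (nothing here closes it)

* FLOOR: `RothRidoutQ` (R0) → `SPartBound F` (R2) → `CoreAFixedSupport F S` (R3) → `SzpiroOnClassWithSupport S` (R4).
* LADDER: `roth → Cell F 0` (L1); `Cell F K`, `K ≥ 1` OPEN; `(∀K, Cell F K) ∧ DeepTail F → Kernel F` (L3) →
  CORE A for `F` (`rad ≤ 6·conductorProxy`) → uniformity over `F` (gen 2 frame) → `IndexFormSzpiroReal` →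
  `assemblyT` → stub.  `MUR → ∀K Cell F K` (L4): the ladder ends exactly at gen 4's ceiling.
* RUNG inside `Cell F 1`: `BennettDahmen2013 ∧ OmitsSUnits F → BDFinite F → PrimePowerIndexBound F` (C4, proved)
  → `SzpiroOnePrimeSlice` (C5).
-/

end Summit.ABC.ABC.Cruxes.IndexSzpiro.StubIdeas2RealG5
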